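import Summits.QuantumFields.YangMills.Theses.CertificationLength

/-!
# Crux attack on `DiagonalFramesAtCertificationScale` (stmt-QuantumFields-16180) — non-vacuity witness

Refuter evidence (not a refutation): the hypotheses of crux (D) are satisfiable over every admissible
gauge group `G` (the `β ≡ 0`, `c ≡ 0` certified scheme with the vacuum-only limit family), and at that
witness the conclusion holds.  Hence (D) is neither vacuous nor refuted by the degenerate scheme.
-/

open scoped SchwartzMap
open MeasureTheory Filter Topology
open Literature.MathematicalPhysics.QuantumLattice Literature.MathematicalPhysics.AQFT
  Literature.MathematicalPhysics.QuantumFieldTheory Literature.Probability.LatticeModels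

noncomputable section

namespace Summit.QuantumFields.YangMills.Cruxes.DiagonalFramesAtCertificationScale.Attack

local notation "E4" => EuclideanSpace ℝ (Fin 4)

section BetaZero

variable {G : Type} [Group G] [TopologicalSpace G] [IsTopologicalGroup G] [CompactSpace G]
  [MeasurableSpace G] [BorelSpace G] {N : ℕ}

/-- At `β = 0` the Wilson specification kernel is the glued product Haar measure. -/
theorem ymSpecification_zero (ρ : G →* Matrix (Fin N) (Fin N) ℂ) (Λ : Finset (ZdEdge 4))
    (ζ : LGConfig 4 G) :
    ymSpecification ρ 0 Λ ζ =
      (Measure.pi fun _ : ↥Λ => haarProbability G).map (glueWith Λ · ζ) := by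
  haveI : IsProbabilityMeasure
      ((Measure.pi fun _ : ↥Λ => haarProbability G).map (glueWith Λ · ζ)) :=
    Measure.isProbabilityMeasure_map (measurable_glueWith Λ ζ).aemeasurable
  simp only [ymSpecification, neg_zero, zero_mul]
  exact tilted_const _ 0

/-- **`β = 0` certificate**: at zero coupling the `γ_Λ(·|η)`-expectation of a cylinder function of
edges inside `Λ` does not depend on the exterior configuration `η`. -/
theorem integral_ymSpecification_zero_eq (ρ : G →* Matrix (Fin N) (Fin N) ℂ)
    (Λ C : Finset (ZdEdge 4)) (hC : C ⊆ Λ) (f : LGConfig 4 G → ℝ) (hf : IsCylinder f C)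
    (hfm : Measurable f) (η η' : LGConfig 4 G) :
    ∫ U, f U ∂(ymSpecification ρ 0 Λ η) = ∫ U, f U ∂(ymSpecification ρ 0 Λ η') := by
  rw [ymSpecification_zero, ymSpecification_zero,
    integral_map (measurable_glueWith Λ η).aemeasurable hfm.aestronglyMeasurable,
    integral_map (measurable_glueWith Λ η').aemeasurable hfm.aestronglyMeasurable]
  refine integral_congr_ae (Eventually.of_forall fun V => ?_)
  refine hf fun e he => ?_
  have he' : e ∈ Λ := hC he
  simp [glueWith_apply_mem _ _ _ he']

end BetaZero

/-- The degenerate certified scheme: `a_k = 1/(k+1)`, `β ≡ 0`, `L_k = 15 (k+1)²`, `c = m ≡ 0`. -/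
def attackScheme (ι : Type) : SpeciesScheme ι where
  a := fun k => 1 / ((k : ℝ) + 1)
  a_pos := fun k => by positivity
  tendsto_a := tendsto_one_div_add_atTop_nhds_zero_nat
  β := fun _ => 0
  L := fun k => 15 * (k + 1) ^ 2
  tendsto_L := by
    have h : (fun k : ℕ => 1 / ((k : ℝ) + 1) * (((15 * (k + 1) ^ 2 : ℕ)) : ℝ)) =
        fun k : ℕ => 15 * ((k : ℝ) + 1) := by
      funext k; push_cast; field_simp
    rw [h]
    exact Tendsto.const_mul_atTop (by norm_num : (0 : ℝ) < 15)
      (tendsto_natCast_atTop_atTop.atTop_add tendsto_const_nhds)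
  c := fun _ _ => 0
  m := fun _ _ => 0

@[simp] theorem attackScheme_c (ι : Type) (s : ι) (k : ℕ) : (attackScheme ι).c s k = 0 := rfl
@[simp] theorem attackScheme_β (ι : Type) (k : ℕ) : (attackScheme ι).β k = 0 := rfl
@[simp] theorem attackScheme_a (ι : Type) (k : ℕ) : (attackScheme ι).a k = 1 / ((k : ℝ) + 1) := rfl
@[simp] theorem attackScheme_L (ι : Type) (k : ℕ) : (attackScheme ι).L k = 15 * (k + 1) ^ 2 := rfl

/-- The vacuum-only one-field family. -/
def vacuumFamily : SchwingerFamily E4 :=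
  fun n => LabelledSchwingerFamily.trivial Unit E4 n fun _ => ()

theorem vacuumFamily_of_ne_zero {n : ℕ} (hn : n ≠ 0) : vacuumFamily n = 0 := by
  simp [vacuumFamily, LabelledSchwingerFamily.trivial_of_ne_zero Unit hn]

theorem vacuumFamily_zero_apply (F : 𝓢((Fin 0 → E4), ℂ)) (x : Fin 0 → E4) :
    vacuumFamily 0 F = F x :=
  LabelledSchwingerFamily.trivial_zero_apply Unit _ F x

section Hyps

variable (G : Type) [Group G] [TopologicalSpace G] [IsTopologicalGroup G] [CompactSpace G]
  [MeasurableSpace G] [BorelSpace G]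

/-- The hypotheses of crux (D), VERBATIM, as a predicate of the data it quantifies over. -/
def Hyps (r : LatticeRep G) (n : ℕ) (ε : ℝ) (ℓ₀ : ℝ) (bseq : ℕ → ℕ)
    (sch : SpeciesScheme (YMSpecies G)) (S₁ : SchwingerFamily E4) : Prop :=
  1 ≤ n ∧ 0 ≤ ε ∧ ε * ((((4 * n + 3) ^ 4 - (4 * n + 1) ^ 4 : ℕ)) : ℝ) < 1 ∧ 0 < ℓ₀ ∧ (∀ k, 0 ≤ sch.β k ∧ 1 ≤ bseq k ∧ (∀ w : Fin 4 → ℤ → ℤ, (∀ i j, w i j + (((bseq k) : ℕ) : ℤ) ≤ w i (j + 1) ∧ w i (j + 1) ≤ w i j + 2 * (((bseq k) : ℕ) : ℤ)) → ∀ Y : Finset (Fin 4 → ℤ), Y ⊆ (Fintype.piFinset fun _ : Fin 4 => Finset.Icc (-(2 * ((n : ℕ) : ℤ))) (2 * ((n : ℕ) : ℤ))) → (0 : Fin 4 → ℤ) ∈ Y → ∀ η η' : LGConfig 4 G, (∀ e ∈ (Fintype.piFinset fun _ : Fin 4 => Finset.Icc (-(2 * ((n : ℕ) : ℤ))) (2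 * ((n : ℕ) : ℤ))).biUnion (fun y : Fin 4 → ℤ => (Fintype.piFinset fun i : Fin 4 => Finset.Ico (w i (y i)) (w i (y i + 1))) ×ˢ (Finset.univ : Finset (Fin 4))), η e = η' e) → ∀ f : LGConfig 4 G → ℝ, IsCylinder f ((fun y : Fin 4 → ℤ => (Fintype.piFinset fun i : Fin 4 => Finset.Ico (w i (y i)) (w i (y i + 1))) ×ˢ (Finset.univ : Finset (Fin 4))) 0) → Measurable f → (∀ U, 0 ≤ f U ∧ f U ≤ 1) → |(∫ U, f U ∂(ymSpecification r.ρ (sch.β k) (Y.biUnion (fun y : Fin 4 → ℤ => (Fintype.piFinset fun i : Fin 4 => Finset.Ico (w i (y i)) (w i (y i + 1))) ×ˢ (Finset.univ : Finset (Fin 4)))) η)) - ∫ U, f U ∂(ymSpecification r.ρ (sch.β k) (Y.biUnion (fun y : Fin 4 → ℤ => (Fintype.piFinset fun i : Fin 4 => Finset.Ico (w i (y i)) (w i (y i + 1))) ×ˢ (Finset.univ : Finset (Fin 4)))) η')| ≤ ε)) ∧ (∀ k, sch.a k = ℓ₀ / (bseq k : ℝ)) ∧ (∀ k, (8 * n +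 7) * bseq k ≤ 2 * sch.L k + 1 ∧ Real.log (|sch.c r.curvature k| + 1) ^ 2 ≤ sch.a k * sch.L k) ∧ (∀ (m : ℕ), m ≠ 0 → ∀ (f : Fin m → SchwartzMap E4 ℝ) (F : SchwartzMap (Fin m → E4) ℂ), IsTensorOf F (fun i => ofRealTest (f i)) → IsOffDiagonal F → Filter.Tendsto (fun k : ℕ => ((latticeSchwinger r.ρ sch (fun s => s.F) k m (fun _ => r.curvature) f : ℝ) : ℂ)) Filter.atTop (nhds (S₁ m F))) ∧ S₁.toLabelled.IsNormalized

/-- The conclusion of crux (D), VERBATIM: RP in pull-back form in the four diagonal frames. -/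
def Concl (S₁ : SchwingerFamily E4) : Prop :=
  ∀ (R : E4 ≃ₗᵢ[ℝ] E4) (a c : ℝ), a ^ 2 = 1 / 2 → c ^ 2 = 1 / 2 → R (EuclideanSpace.single 0 1) = a • EuclideanSpace.single 0 1 + c • EuclideanSpace.single 1 1 → (SchwingerFamily.toLabelled (fun m => (S₁ m).comp (linActMulti R))).IsReflectionPositive

end Hyps

/-- Readback (kernel-checked, definitional up to currying): crux (D) says `Hyps → Concl` for all data. -/
theorem crux_iff :
    Summit.QuantumFields.YangMills.Theses.CertificationLength.DiagonalFramesAtCertificationScale ↔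
      ∀ (G : Type) [Group G] [TopologicalSpace G] [IsTopologicalGroup G] [CompactSpace G],
        IsCompactSimpleLieGroup G → letI : MeasurableSpace G := borel G; haveI : BorelSpace G := ⟨rfl⟩;
        ∀ (r : LatticeRep G) (n : ℕ) (ε : ℝ) (ℓ₀ : ℝ) (bseq : ℕ → ℕ)
          (sch : SpeciesScheme (YMSpecies G)) (S₁ : SchwingerFamily E4),
          Hyps G r n ε ℓ₀ bseq sch S₁ → Concl S₁ := by
  constructor
  · intro h G _ _ _ _ hG
    letI : MeasurableSpace G := borel G
    haveI : BorelSpace G := ⟨rfl⟩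
    intro r n ε ℓ₀ bseq sch S₁ hH
    obtain ⟨hn, hε, hM, hℓ, hcert, ha, hL, hconv, hE0⟩ := hH
    exact h G hG r n ε hn hε hM ℓ₀ bseq sch S₁ hℓ hcert ha hL hconv hE0
  · intro h G _ _ _ _ hG
    letI : MeasurableSpace G := borel G
    haveI : BorelSpace G := ⟨rfl⟩
    intro r n ε hn hε hM ℓ₀ bseq sch S₁ hℓ hcert ha hL hconv hE0
    exact h G hG r n ε ℓ₀ bseq sch S₁ ⟨hn, hε, hM, hℓ, hcert, ha, hL, hconv, hE0⟩

/-- **Non-vacuity of crux (D)**: over every admissible `G` the hypotheses are inhabited — by any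
faithful `r`, `n = 1`, `ε = 0`, `ℓ₀ = 1`, `b_k = k+1`, the `β ≡ 0`, `c ≡ 0` scheme `attackScheme` and the
vacuum-only family. -/
theorem hyps_satisfiable (G : Type) [Group G] [TopologicalSpace G] [IsTopologicalGroup G]
    [CompactSpace G] [MeasurableSpace G] [BorelSpace G] (r : LatticeRep G) :
    Hyps G r 1 0 1 (fun k => k + 1) (attackScheme (YMSpecies G)) vacuumFamily := by
  refine ⟨le_rfl, le_rfl, by norm_num, one_pos, fun k => ⟨le_rfl, Nat.le_add_left 1 k, ?_⟩, ?_, ?_, ?_, ?_⟩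
  · -- the TV finite-size condition at β = 0 with ε = 0
    intro w hw Y hY h0 η η' hηη' f hf hfm hf01
    have hsub : ((fun y : Fin 4 → ℤ => (Fintype.piFinset fun i : Fin 4 =>
        Finset.Ico (w i (y i)) (w i (y i + 1))) ×ˢ (Finset.univ : Finset (Fin 4))) 0) ⊆
        Y.biUnion (fun y : Fin 4 → ℤ => (Fintype.piFinset fun i : Fin 4 =>
          Finset.Ico (w i (y i)) (w i (y i + 1))) ×ˢ (Finset.univ : Finset (Fin 4))) :=
      Finset.subset_biUnion_of_mem (fun y : Fin 4 → ℤ => (Fintype.piFinset fun i : Fin 4 =>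
          Finset.Ico (w i (y i)) (w i (y i + 1))) ×ˢ (Finset.univ : Finset (Fin 4))) h0
    rw [attackScheme_β, integral_ymSpecification_zero_eq r.ρ _ _ hsub f hf hfm η η', sub_self,
      abs_zero]
  · intro k
    simp only [attackScheme_a]
    push_cast
    ring
  · intro k
    refine ⟨?_, ?_⟩
    · simp only [attackScheme_L]
      have h1 : k + 1 ≤ (k + 1) ^ 2 := Nat.le_self_pow two_ne_zero _
      linarith
    · simp only [attackScheme_c, attackScheme_a, attackScheme_L, abs_zero, zero_add, Real.log_one]
      rw [zero_pow two_ne_zero]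
      positivity
  · intro m hm f F _ _
    obtain ⟨j, rfl⟩ := Nat.exists_eq_succ_of_ne_zero hm
    rw [vacuumFamily_of_ne_zero hm]
    refine tendsto_const_nhds.congr' (Eventually.of_forall fun k => ?_)
    simp [latticeSchwinger, smearedLatticeField]
  · intro k F
    exact vacuumFamily_zero_apply F _

/-- At the degenerate witness the pulled-back family is again the vacuum-only family … -/
theorem vacuumFamily_pullback (R : E4 ≃ₗᵢ[ℝ] E4) :
    (SchwingerFamily.toLabelled (fun m => (vacuumFamily m).comp (linActMulti R))) =
      LabelledSchwingerFamily.trivial Unit E4 := by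
  funext n k
  ext F
  rcases Nat.eq_zero_or_pos n with rfl | hn
  · simp only [SchwingerFamily.toLabelled_apply, ContinuousLinearMap.coe_comp, Function.comp_apply]
    rw [vacuumFamily_zero_apply _ 0, LabelledSchwingerFamily.trivial_zero_apply Unit k F 0,
      linActMulti_apply]
    congr 1
    exact Subsingleton.elim _ _
  · simp [vacuumFamily_of_ne_zero hn.ne', LabelledSchwingerFamily.trivial_of_ne_zero Unit hn.ne']

/-- … so the conclusion of (D) holds at the witness (the degenerate scheme does not refute (D)). -/
theorem concl_vacuumFamily : Concl vacuumFamily := by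
  intro R a c _ _ _
  rw [vacuumFamily_pullback R]
  exact (OSAxiomsSchwinger.trivial (ι := Unit) (d := 4)).reflectionPositive

end Summit.QuantumFields.YangMills.Cruxes.DiagonalFramesAtCertificationScale.Attack

end
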